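import Literature.Probability.RandomPlanarGeometry.SLESixHullLocalityFact
import Literature.Probability.RandomPlanarGeometry.SLESixHullLocalityPullback
import Literature.Probability.RandomPlanarGeometry.SLESixSplittingReduction
import Literature.Probability.RandomPlanarGeometry.StopAtThickening
import Literature.Probability.RandomPlanarGeometry.LoewnerCurveLimitDomain
import Literature.Probability.RandomPlanarGeometry.BoundaryCorrespondence
import Literature.Probability.RandomPlanarGeometry.RohdeSchrammCor35Proofs
import HarnessLib

/-!
# Locality of chordal SLE₆, restriction form, for hull subdomains — reduced to the half-plane

Topic `Probability/RandomPlanarGeometry`; theorems only. The bounded clause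
`IsSLELaw.locality_six_bounded` of the restriction form of the locality of chordal SLE₆
(Lawler–Schramm–Werner (2001), Cor. 2.4 with its printed hypothesis `a, b ∉ \bar I`, i.e. for
HULL SUBDOMAINS `D' ⊆ D`, `MarkedDomain.IsHullSubdomain`) follows from the half-plane form
`sle_six_hull_locality` (both in `SLESixHullLocalityFact.lean`):

* `measure_stopAt_preimage_eq_of_hull` — core: for a closed `G` off `a`, containing a
  thickening of `F = closure (D ∖ D')` and a ball around `b`, the `μ'`- and `μ`-laws of the
  classes stopped at `G` agree. Write `μ = law (Ψ ∘ γ)^` for a chordal map `ψ` of `D`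
  (`Ψ = ψ.boundaryExtension`, `γ` the SLE₆ trace, `^` = time compactification) and
  `μ' = law (Ψ' ∘ γ)^` for the chordal map `ψ' = ψ ∘ Φ_A⁻¹` of `D'`
  (`ConformalEquiv.pullbackChordal`, `A = ψ.pullbackHull D' ∈ 𝒬*`), by uniqueness in law.
  Stopping at `G` is stopping `γ` at `S' = Ψ⁻¹ G`, resp. at `S = Ψ'⁻¹ G` (closed half-plane),
  with `z ∈ S' ↔ E_A z ∈ S` (`Ψ' ∘ E_A = Ψ` off `A`); `S'` is hit (it contains a neighbourhood
  of `∞`, transience) strictly before `A` (`Ψ(A) ⊆ F` and `G ⊇ F_δ`); and the stopped `μ`-class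
  is the `Ψ'♯`-image of the class of `E_A ∘ γ` stopped at `S'`, the stopped `μ'`-class the
  `Ψ'♯`-image of the class of `γ` stopped at `S` (`mk_stopAt_eq_stoppedPathClass`), so the
  half-plane fact, tested on `(map Ψ'♯)⁻¹ T`, gives the claim;
* `measure_stopAt_preimage_eq_of_pt_zero_mem` — the degenerate case `a ∈ G` (both stopped
  classes are a.s. the constant class at `a`);
* **`IsSLELaw.locality_six_bounded_of_hull`** — the clause for `F`: by the two lemmas it holds
  for every closed thickening of `F ∪ {b}`, hence for `F ∪ {b}`
  (`measure_preimage_stopAt_eq_of_forall_cthickening`), and stopping at `F ∪ {b}` is stopping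
  at `F` almost surely (the curves visit `b` only at the end,
  `MarkedDomain.boundaryExtension_ne_pt_one`, `Curve.stopAt_union_eq_of`).

References: Lawler–Schramm–Werner, Acta Math. 187 (2001), Thm. 2.2, Cor. 2.4; JAMS 16 (2003), §5.
-/

noncomputable section

open Set Filter Topology MeasureTheory Complex Metric
open UpperHalfPlane (upperHalfPlaneSet)
open scoped NNReal unitInterval

namespace Literature.Probability.RandomPlanarGeometry

open Literature.Probability.Process

/-! ### Hitting a set containing a neighbourhood of infinity -/

/-- If `Φ → b` at infinity in the closed half-plane and `G` contains a ball around `b`, then the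
closed-half-plane preimage of `G` contains the closed half-plane outside a large disc. [folklore] -/
theorem exists_forall_mem_of_tendsto_cocompact {Φ : ℂ → ℂ} {b : ℂ}
    (hΦ : Tendsto Φ (cocompact ℂ ⊓ 𝓟 {z : ℂ | 0 ≤ z.im}) (𝓝 b)) {G : Set ℂ} {r : ℝ} (hr : 0 < r)
    (hG : closedBall b r ⊆ G) :
    ∃ R : ℝ, ∀ z : ℂ, 0 ≤ z.im → R ≤ ‖z‖ → Φ z ∈ G := by
  have h1 : ∀ᶠ z in cocompact ℂ ⊓ 𝓟 {z : ℂ | 0 ≤ z.im}, Φ z ∈ closedBall b r :=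
    hΦ (closedBall_mem_nhds b hr)
  rw [eventually_inf_principal] at h1
  obtain ⟨K, hK, hKsub⟩ := mem_cocompact.1 h1
  obtain ⟨R, hR⟩ := hK.isBounded.subset_closedBall 0
  refine ⟨R + 1, fun z hz hRz ↦ hG ?_⟩
  refine hKsub (fun hzK ↦ ?_) hz
  have := hR hzK
  rw [mem_closedBall, dist_zero_right] at this
  linarith

/-- A transient path in the closed half-plane hits every set containing the closed half-plane
outside a large disc, in finite time. [folklore] -/
theorem firstHit_ne_top_of_tendsto_norm {γ : ℝ≥0 → ℂ} (him : ∀ t, 0 ≤ (γ t).im)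
    (htr : Tendsto (fun t ↦ ‖γ t‖) atTop atTop) {S : Set ℂ} {R : ℝ}
    (hS : ∀ z : ℂ, 0 ≤ z.im → R ≤ ‖z‖ → z ∈ S) : firstHit γ S ≠ ⊤ := by
  obtain ⟨t, ht⟩ := (htr.eventually_ge_atTop R).exists
  exact ne_top_of_le_ne_top WithTop.coe_ne_top (firstHit_le (hS _ (him t) ht))

/-! ### Stopping at the first hit strictly before the hull -/

/-- **The pulled-back stopping set is hit strictly before the hull.** If `Ψ(A) ⊆ F`, `G`
contains the `δ`-thickening of `F`, the path starts off `A` at a point sent off `G`... precisely: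
for a continuous path `γ` in the closed half-plane with `γ 0 ∉ A`, `t ↦ Ψ (γ t)` continuous, if
`S' ⊇ {z | 0 ≤ im z ∧ Ψ z ∈ G}` is hit in finite time then it is hit strictly before `A`.
[folklore] -/
theorem firstHit_lt_firstHit_of_thickening {γ : ℝ≥0 → ℂ} {Ψ : ℂ → ℂ} {A F G S' : Set ℂ}
    (hγ : Continuous γ) (hA : IsClosed A) (h0 : γ 0 ∉ A)
    (hcont : Continuous fun t : ℝ ↦ Ψ (γ t.toNNReal)) (hΨA : ∀ z ∈ A, Ψ z ∈ F)
    {δ : ℝ} (hδ : 0 < δ) (hFG : cthickening δ F ⊆ G)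
    (hS' : ∀ t, Ψ (γ t) ∈ G → γ t ∈ S') (hfin : firstHit γ S' ≠ ⊤) :
    firstHit γ S' < firstHit γ A := by
  by_cases hAtop : firstHit γ A = ⊤
  · rw [hAtop]; exact lt_top_iff_ne_top.2 hfin
  obtain ⟨tA, htA, hγtA⟩ := exists_firstHit_eq_coe hγ hA hAtop
  have htA0 : tA ≠ 0 := fun h ↦ h0 (h ▸ hγtA)
  have htApos : 0 < (tA : ℝ) := by
    have := pos_iff_ne_zero.2 htA0
    exact_mod_cast this
  -- continuity of `t ↦ Ψ (γ t)` at `tA` : a slightly earlier time is `δ`-close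
  have hF : Ψ (γ tA) ∈ F := hΨA _ hγtA
  have hc : ContinuousAt (fun t : ℝ ↦ Ψ (γ t.toNNReal)) tA := hcont.continuousAt
  obtain ⟨η, hη, hball⟩ := Metric.continuousAt_iff.1 hc δ hδ
  set t : ℝ := (tA : ℝ) - min (η / 2) ((tA : ℝ) / 2) with htdef
  have hmin : 0 < min (η / 2) ((tA : ℝ) / 2) := lt_min (by linarith) (by linarith)
  have ht0 : 0 ≤ t := by
    have : min (η / 2) ((tA : ℝ) / 2) ≤ tA / 2 := min_le_right _ _
    rw [htdef]; linarith
  have htlt : t < tA := by rw [htdef]; linarith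
  have hdist : dist t tA < η := by
    rw [dist_comm, Real.dist_eq, abs_of_pos (by linarith)]
    calc (tA : ℝ) - t = min (η / 2) ((tA : ℝ) / 2) := by rw [htdef]; ring
      _ ≤ η / 2 := min_le_left _ _
      _ < η := by linarith
  have hclose : dist (Ψ (γ t.toNNReal)) (Ψ (γ tA)) < δ := by
    have := hball hdist
    simpa only [Real.toNNReal_coe] using this
  have hG : Ψ (γ t.toNNReal) ∈ G :=
    hFG (Metric.mem_cthickening_of_dist_le _ _ _ _ hF hclose.le)
  have h1 : firstHit γ S' ≤ (t.toNNReal : ℝ≥0) := firstHit_le (hS' _ hG)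
  have h2 : ((t.toNNReal : ℝ≥0) : WithTop ℝ≥0) < tA := by
    have : t.toNNReal < tA := by
      rw [← NNReal.coe_lt_coe, Real.coe_toNNReal _ ht0]; exact htlt
    exact_mod_cast this
  rw [htA]
  exact h1.trans_lt h2

/-! ### The core reduction -/

/-- **Core of the reduction** (for a fixed chordal map `ψ` of `(D; a, b)` realising `μ`): for a
closed `G` containing a thickening of `F = closure (D ∖ D')` and a ball around `b`, the
law of the `μ'`-class stopped at `G` equals that of the `μ`-class stopped at `G`, given the
half-plane fact. [cite: LawlerSchrammWerner2001, Thm 2.2 and Cor 2.4] -/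
theorem measure_stopAt_preimage_eq_of_hull (hH : sle_six_hull_locality) {D D' : DobrushinDomain}
    (hD' : D.IsHullSubdomain D') (hne : D'.carrier ≠ D.carrier)
    {Γ : (ℝ≥0 → ℝ) → CurveClass ℂ} (hΓm : AEMeasurable Γ preWienerMeasure)
    (ψ : ConformalEquiv upperHalfPlaneSet D.carrier) (hψ : D.IsChordalUniformizing ψ)
    (hae : ∀ᵐ ω ∂preWienerMeasure, Loewner.IsGeneratedByCurve (sleDriving 6 ω) (sleTrace 6 ω) ∧
      ∃ c : Curve ℂ, Γ ω = CurveClass.mk c ∧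
        IsCompactifiedImage ψ.boundaryExtension (sleTrace 6 ω) (D.pt 1) c)
    {μ' : Measure (CurveClass ℂ)} (hμ' : IsSLELaw 6 D' μ')
    {G : Set ℂ} (hG : IsClosed G)
    {δ : ℝ} (hδ : 0 < δ) (hFG : cthickening δ (closure (D.carrier \ D'.carrier)) ⊆ G)
    {r : ℝ} (hr : 0 < r) (hbG : closedBall (D.pt 1) r ⊆ G)
    {T : Set (CurveClass ℂ)} (hT : MeasurableSet T) :
    μ' (CurveClass.stopAt G ⁻¹' T) = preWienerMeasure.map Γ (CurveClass.stopAt G ⁻¹' T) := by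
  have hC := JordanDomain.exists_continuousOn_extension_holds
  have hext := JordanDomain.continuousOn_boundaryExtension_holds
  have hcl : closure upperHalfPlaneSet = {w : ℂ | 0 ≤ w.im} := Complex.closure_setOf_lt_im 0
  have hTr : HasSLETrace 6 := hae.mono fun ω hω ↦ ⟨_, hω.1⟩
  have htr := tendsto_norm_sleTrace_atTop_of_ne_eight (κ := 6) (by norm_num) (by norm_num)
  -- the pulled-back hull and the chordal map `ψ' = ψ ∘ Φ_A⁻¹` of `D'`
  set A : Set ℂ := ψ.pullbackHull D' with hAdef
  have hA : IsStarHull A := IsStarHull.pullbackHull JordanDomain.isSimplyConnected_holds hψ hD'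
  have hAne : A.Nonempty := ConformalEquiv.pullbackHull_nonempty (ψ := ψ) hD'.carrier_subset hne
  have hAcl : IsClosed A := hA.1.isClosed
  set ψ' := ψ.pullbackChordal hD'.carrier_subset hA with hψ'def
  have hψ' : D'.IsChordalUniformizing ψ' := ConformalEquiv.isChordalUniformizing_pullbackChordal hψ hD' hA
  have hb' : D'.pt 1 = D.pt 1 := hD'.pt_one_eq
  -- `μ'` through `ψ'`
  obtain ⟨Γ', hΓ'm, hae'⟩ := exists_isSLECurve_through_of_ae_tendsto (D := D') hTr htr hext
    (aemeasurable_sleTrace_holds hTr) hψ'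
  have hμ'eq : μ' = preWienerMeasure.map Γ' :=
    hμ'.eq_map_of_isSLECurve (IsSLECurve.of_through hψ' hΓ'm hae')
  rw [hμ'eq, CurveClass.map_apply_stopAt_preimage hΓ'm hG hT,
    CurveClass.map_apply_stopAt_preimage hΓm hG hT]
  -- continuous extensions and the transported test set
  have hΨcont : ContinuousOn ψ.boundaryExtension (closure upperHalfPlaneSet) := hext D.toJordanDomain ψ
  have hΨ'cont : ContinuousOn ψ'.boundaryExtension (closure upperHalfPlaneSet) :=
    hext D'.toJordanDomain ψ'
  obtain ⟨Ψs, hΨs⟩ := exists_continuousMap_eq_of_continuousOn_closure hΨ'cont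
  set T' : Set (CurveClass ℂ) := CurveClass.map Ψs ⁻¹' T with hT'def
  have hT' : MeasurableSet T' := hT.preimage (CurveClass.measurable_map Ψs)
  -- the stopping sets in the half-plane
  set S : Set ℂ := {w | 0 ≤ w.im ∧ ψ'.boundaryExtension w ∈ G} with hSdef
  set S' : Set ℂ := {z | 0 ≤ z.im ∧ ψ.boundaryExtension z ∈ G} with hS'def
  have hclosed : ∀ {Φ : ℂ → ℂ}, ContinuousOn Φ (closure upperHalfPlaneSet) →
      IsClosed {w : ℂ | 0 ≤ w.im ∧ Φ w ∈ G} := fun {Φ} hΦ ↦ by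
    have : {w : ℂ | 0 ≤ w.im ∧ Φ w ∈ G} = closure upperHalfPlaneSet ∩ Φ ⁻¹' G := by
      rw [hcl]; rfl
    rw [this]
    exact hΦ.preimage_isClosed_of_isClosed (hcl ▸ isClosed_le continuous_const Complex.continuous_im) hG
  have hS : IsClosed S := hclosed hΨ'cont
  have hS'c : IsClosed S' := hclosed hΨcont
  -- the dictionary `z ∈ S' ↔ E_A z ∈ S`
  have hdict : ∀ z : ℂ, 0 ≤ z.im → z ∉ A → (z ∈ S' ↔ starMap A z ∈ S) := fun z hz hzA ↦ by
    simp only [hSdef, hS'def, mem_setOf_eq]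
    rw [ConformalEquiv.boundaryExtension_pullbackChordal_starMap hD'.carrier_subset hA hz hzA]
    exact ⟨fun h ↦ ⟨starMap_im_nonneg hA hz hzA, h.2⟩, fun h ↦ ⟨hz, h.2⟩⟩
  -- large half-plane points are in `S'` and in `S`
  obtain ⟨R', hR'⟩ := exists_forall_mem_of_tendsto_cocompact
    (MarkedDomain.IsChordalUniformizing.tendsto_boundaryExtension_cocompact hψ) hr hbG
  obtain ⟨R, hR⟩ := exists_forall_mem_of_tendsto_cocompact
    (MarkedDomain.IsChordalUniformizing.tendsto_boundaryExtension_cocompact hψ') hr (hb' ▸ hbG)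
  -- `Ψ(A) ⊆ F`
  have hΨA : ∀ z ∈ A, ψ.boundaryExtension z ∈ closure (D.carrier \ D'.carrier) := fun z hz ↦
    ConformalEquiv.boundaryExtension_mem_closure_diff_of_mem_pullbackHull hΨcont hz
  -- the a.s. strict hitting hypothesis of the half-plane fact
  have hlt : ∀ᵐ ω ∂preWienerMeasure, firstHit (sleTrace 6 ω) S' < firstHit (sleTrace 6 ω) A := by
    filter_upwards [hae, htr] with ω hω hωtr
    have hgen := hω.1
    have him := hgen.im_nonneg
    have h0 : sleTrace 6 ω 0 ∉ A := by
      rw [hgen.apply_zero, sleDriving_zero]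
      exact_mod_cast ConformalEquiv.zero_notMem_pullbackHull hψ hD'
    have hfin : firstHit (sleTrace 6 ω) S' ≠ ⊤ :=
      firstHit_ne_top_of_tendsto_norm him hωtr fun z hz hRz ↦ ⟨hz, hR' z hz hRz⟩
    exact firstHit_lt_firstHit_of_thickening hgen.continuous hAcl h0
      (continuous_comp_of_isGeneratedByCurve hΨcont hgen) hΨA hδ hFG
      (fun t ht ↦ ⟨him t, ht⟩) hfin
  have key := hH hA hAne hS hS'c hdict hlt T' hT'
  -- identification of the `μ`-event
  have h1 : Γ ⁻¹' (CurveClass.stopAt G ⁻¹' T) =ᵐ[preWienerMeasure]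
      {ω | stoppedPathClass (starMap A) (sleTrace 6 ω)
        ((firstHit (sleTrace 6 ω) S').untopD 0) ∈ T'} := by
    filter_upwards [hae, hlt, htr] with ω hω hωlt hωtr
    obtain ⟨hgen, c, hΓc, hc⟩ := hω
    have him := hgen.im_nonneg
    have hfin : firstHit (sleTrace 6 ω) S' ≠ ⊤ :=
      firstHit_ne_top_of_tendsto_norm him hωtr fun z hz hRz ↦ ⟨hz, hR' z hz hRz⟩
    obtain ⟨τ, hτ, -⟩ := exists_firstHit_eq_coe hgen.continuous hS'c hfin
    refine propext ?_
    change Γ ω ∈ CurveClass.stopAt G ⁻¹' T ↔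
      stoppedPathClass (starMap A) (sleTrace 6 ω)
        ((firstHit (sleTrace 6 ω) S').untopD 0) ∈ CurveClass.map Ψs ⁻¹' T
    rw [hΓc, mem_preimage, CurveClass.stopAt_mk_holds _ hG, mem_preimage, hτ, WithTop.untopD_coe]
    have hΨF : ∀ t, ψ.boundaryExtension (sleTrace 6 ω t) ∈ G ↔ sleTrace 6 ω t ∈ S' :=
      fun t ↦ ⟨fun h ↦ ⟨him t, h⟩, fun h ↦ h.2⟩
    have hcontψ := continuous_comp_of_isGeneratedByCurve hΨcont hgen
    have hA' := mk_stopAt_eq_stoppedPathClass hG hS'c hgen.continuous hΨF hc hτ hcontψ.continuousOn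
    rw [hA']
    -- off `A` up to time `τ`
    have hτA : (τ : WithTop ℝ≥0) < firstHit (sleTrace 6 ω) A := hτ ▸ hωlt
    have hnotA : ∀ s : I, sleTrace 6 ω (((τ : ℝ) * s).toNNReal) ∉ A := fun s ↦ by
      refine notMem_of_lt_firstHit (lt_of_le_of_lt ?_ hτA)
      have : ((τ : ℝ) * s).toNNReal ≤ τ := by
        rw [← NNReal.coe_le_coe, Real.coe_toNNReal _ (mul_nonneg τ.coe_nonneg s.2.1)]
        exact mul_le_of_le_one_right τ.coe_nonneg s.2.2
      exact_mod_cast this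
    have hcontL : Continuous (fun s : I ↦ ψ.boundaryExtension
        (sleTrace 6 ω (((τ : ℝ) * s).toNNReal))) :=
      hcontψ.comp (continuous_const.mul continuous_subtype_val)
    have hpath : Continuous fun s : I ↦ sleTrace 6 ω (((τ : ℝ) * s).toNNReal) :=
      hgen.continuous.comp (continuous_real_toNNReal.comp (continuous_const.mul continuous_subtype_val))
    have hcontR : Continuous (fun s : I ↦ starMap A (sleTrace 6 ω (((τ : ℝ) * s).toNNReal))) :=
      (continuousOn_starMap hA).comp_continuous hpath fun s ↦ ⟨him _, hnotA s⟩
    rw [stoppedPathClass_eq hcontL, stoppedPathClass_eq hcontR, CurveClass.map_mk]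
    have heq : (⟨⟨fun s : I ↦ ψ.boundaryExtension (sleTrace 6 ω (((τ : ℝ) * s).toNNReal)),
        hcontL⟩⟩ : Curve ℂ) =
        Curve.map Ψs ⟨⟨fun s : I ↦ starMap A (sleTrace 6 ω (((τ : ℝ) * s).toNNReal)), hcontR⟩⟩ := by
      refine Curve.ext (ContinuousMap.ext fun s ↦ ?_)
      change ψ.boundaryExtension (sleTrace 6 ω (((τ : ℝ) * s).toNNReal)) =
        Ψs (starMap A (sleTrace 6 ω (((τ : ℝ) * s).toNNReal)))
      rw [hΨs _ (starMap_im_nonneg hA (him _) (hnotA s)),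
        ConformalEquiv.boundaryExtension_pullbackChordal_starMap hD'.carrier_subset hA (him _) (hnotA s)]
    rw [heq]
  -- identification of the `μ'`-event
  have h2 : Γ' ⁻¹' (CurveClass.stopAt G ⁻¹' T) =ᵐ[preWienerMeasure]
      {ω | stoppedPathClass id (sleTrace 6 ω)
        ((firstHit (sleTrace 6 ω) S).untopD 0) ∈ T'} := by
    filter_upwards [hae', htr] with ω hω hωtr
    obtain ⟨hgen, c', hΓ'c, hc'⟩ := hω
    have him := hgen.im_nonneg
    have hfin : firstHit (sleTrace 6 ω) S ≠ ⊤ :=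
      firstHit_ne_top_of_tendsto_norm him hωtr fun z hz hRz ↦ ⟨hz, hR z hz hRz⟩
    obtain ⟨τ, hτ, -⟩ := exists_firstHit_eq_coe hgen.continuous hS hfin
    refine propext ?_
    change Γ' ω ∈ CurveClass.stopAt G ⁻¹' T ↔
      stoppedPathClass id (sleTrace 6 ω)
        ((firstHit (sleTrace 6 ω) S).untopD 0) ∈ CurveClass.map Ψs ⁻¹' T
    rw [hΓ'c, mem_preimage, CurveClass.stopAt_mk_holds _ hG, mem_preimage, hτ, WithTop.untopD_coe]
    have hΨF : ∀ t, ψ'.boundaryExtension (sleTrace 6 ω t) ∈ G ↔ sleTrace 6 ω t ∈ S :=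
      fun t ↦ ⟨fun h ↦ ⟨him t, h⟩, fun h ↦ h.2⟩
    have hcontψ' := continuous_comp_of_isGeneratedByCurve hΨ'cont hgen
    have hb'' : D'.pt 1 = D'.pt 1 := rfl
    have hA' := mk_stopAt_eq_stoppedPathClass hG hS hgen.continuous hΨF hc' hτ hcontψ'.continuousOn
    rw [hA']
    have hcontL : Continuous (fun s : I ↦ ψ'.boundaryExtension
        (sleTrace 6 ω (((τ : ℝ) * s).toNNReal))) :=
      hcontψ'.comp (continuous_const.mul continuous_subtype_val)
    have hcontR := continuous_stoppedPath_id hgen.continuous τ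
    rw [stoppedPathClass_eq hcontL, stoppedPathClass_eq hcontR, CurveClass.map_mk]
    have heq : (⟨⟨fun s : I ↦ ψ'.boundaryExtension (sleTrace 6 ω (((τ : ℝ) * s).toNNReal)),
        hcontL⟩⟩ : Curve ℂ) =
        Curve.map Ψs ⟨⟨fun s : I ↦ id (sleTrace 6 ω (((τ : ℝ) * s).toNNReal)), hcontR⟩⟩ := by
      refine Curve.ext (ContinuousMap.ext fun s ↦ ?_)
      change ψ'.boundaryExtension (sleTrace 6 ω (((τ : ℝ) * s).toNNReal)) =
        Ψs (id (sleTrace 6 ω (((τ : ℝ) * s).toNNReal)))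
      rw [id, hΨs _ (him _)]
    rw [heq]
  rw [measure_congr h2, measure_congr h1]
  exact key.symm

/-! ### From `F ∪ {b}` to `F`, and the assembly -/

/-- **Stopping at `F ∪ {b}` is stopping at `F`, almost surely**: the compactified image of the
SLE trace under the boundary extension of a chordal map visits `b` only at the final parameter
(`MarkedDomain.boundaryExtension_ne_pt_one`). [folklore] -/
theorem preimage_stopAt_union_pt_one_ae_eq {D : DobrushinDomain}
    {Γ : (ℝ≥0 → ℝ) → CurveClass ℂ} (ψ : ConformalEquiv upperHalfPlaneSet D.carrier)
    (hψ : D.IsChordalUniformizing ψ)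
    (hae : ∀ᵐ ω ∂preWienerMeasure, Loewner.IsGeneratedByCurve (sleDriving 6 ω) (sleTrace 6 ω) ∧
      ∃ c : Curve ℂ, Γ ω = CurveClass.mk c ∧
        IsCompactifiedImage ψ.boundaryExtension (sleTrace 6 ω) (D.pt 1) c)
    {F : Set ℂ} (hF : IsClosed F) (T : Set (CurveClass ℂ)) :
    Γ ⁻¹' (CurveClass.stopAt F ⁻¹' T) =ᵐ[preWienerMeasure]
      Γ ⁻¹' (CurveClass.stopAt (F ∪ {D.pt 1}) ⁻¹' T) := by
  have hC := JordanDomain.exists_continuousOn_extension_holds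
  filter_upwards [hae] with ω hω
  obtain ⟨hgen, c, hΓc, hc⟩ := hω
  have hend : ∀ t : I, c t ∈ ({D.pt 1} : Set ℂ) → (t : ℝ) = 1 := fun t ht ↦ by
    by_contra h1
    have hlt : (t : ℝ) < 1 := lt_of_le_of_ne t.2.2 h1
    rw [mem_singleton_iff, hc.1 t hlt] at ht
    exact MarkedDomain.boundaryExtension_ne_pt_one hC hψ (hgen.im_nonneg _) ht
  refine propext ?_
  change Γ ω ∈ CurveClass.stopAt F ⁻¹' T ↔ Γ ω ∈ CurveClass.stopAt (F ∪ {D.pt 1}) ⁻¹' T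
  rw [mem_preimage, mem_preimage, hΓc, CurveClass.stopAt_mk_holds _ hF,
    CurveClass.stopAt_mk_holds _ (hF.union isClosed_singleton), Curve.stopAt_union_eq_of hend]

/-- **The bounded clause of the restriction form of the locality of chordal SLE₆, from the
half-plane form** ([LSW 2001] Cor. 2.4 for hull subdomains, i.e. under its printed hypothesis
`a, b ∉ \bar I`): `IsSLELaw.locality_six_bounded` follows from `sle_six_hull_locality`.
[cite: LawlerSchrammWerner2001, Cor 2.4] -/
theorem IsSLELaw.locality_six_bounded_of_hull (hH : sle_six_hull_locality) :
    IsSLELaw.locality_six_bounded := by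
  intro D D' μ μ' hμ hμ' hD' T hT
  haveI : Fact isProjectiveLimit_preWienerMeasure := ⟨isProjectiveLimit_preWienerMeasure_holds⟩
  by_cases hne : D'.carrier = D.carrier
  · -- equal carriers: the two laws coincide
    rw [hμ'.unique' (hμ.of_carrier_eq hne hD'.pt_zero_eq hD'.pt_one_eq)]
  set F : Set ℂ := closure (D.carrier \ D'.carrier) with hFdef
  have hF : IsClosed F := isClosed_closure
  haveI := hμ.isProbabilityMeasure
  haveI := hμ'.isProbabilityMeasure
  obtain ⟨Γ, ⟨hΓm, ψ, hψ, hae⟩, rfl⟩ := hμ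
  obtain ⟨Γ', ⟨hΓ'm, ψ', hψ', hae'⟩, hμ'eq⟩ := id hμ'
  -- the clause for every thickening of `F ∪ {b}`
  have hclause : ∀ n : ℕ, ∀ T : Set (CurveClass ℂ), MeasurableSet T →
      μ' (CurveClass.stopAt (cthickening (1 / ((n : ℝ) + 1)) (F ∪ {D.pt 1})) ⁻¹' T) =
        preWienerMeasure.map Γ
          (CurveClass.stopAt (cthickening (1 / ((n : ℝ) + 1)) (F ∪ {D.pt 1})) ⁻¹' T) := by
    intro n T hT
    have hδ : 0 < 1 / ((n : ℝ) + 1) := by positivity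
    refine measure_stopAt_preimage_eq_of_hull hH hD' hne hΓm ψ hψ hae hμ' isClosed_cthickening hδ
      (cthickening_subset_of_subset _ subset_union_left) hδ ?_ hT
    exact (closedBall_subset_cthickening_singleton _ _).trans
      (cthickening_subset_of_subset _ subset_union_right)
  have hunion : μ' (CurveClass.stopAt (F ∪ {D.pt 1}) ⁻¹' T) =
      preWienerMeasure.map Γ (CurveClass.stopAt (F ∪ {D.pt 1}) ⁻¹' T) :=
    measure_preimage_stopAt_eq_of_forall_cthickening (hF.union isClosed_singleton) hclause hT
  -- from `F ∪ {b}` to `F`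
  rw [hμ'eq, CurveClass.map_apply_stopAt_preimage hΓ'm hF hT,
    CurveClass.map_apply_stopAt_preimage hΓm hF hT,
    measure_congr (preimage_stopAt_union_pt_one_ae_eq ψ' hψ' hae' hF T),
    measure_congr (preimage_stopAt_union_pt_one_ae_eq ψ hψ hae hF T), hD'.pt_one_eq,
    ← CurveClass.map_apply_stopAt_preimage hΓ'm (hF.union isClosed_singleton) hT,
    ← CurveClass.map_apply_stopAt_preimage hΓm (hF.union isClosed_singleton) hT, ← hμ'eq]
  exact hunion

end Literature.Probability.RandomPlanarGeometry

end
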